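import Summits.QuantumFields.BalabanUV.Beta.D1BFx.GhostDeltaJetMasses
import Summits.QuantumFields.BalabanUV.Beta.D1BFx.GhostVertexDensities
import Summits.QuantumFields.BalabanUV.Beta.D1BFx.NeedleBondMarginal

/-!
# `BalabanUV.Beta.D1BFx.GhostQVertexDensity` — road «BF-x» for binder row D1, slot (K), GHOST-N8-SPEC v0.3 §3 LETTER L-Q′:
# **THE PACKED `Q′`-VERTEX IS A BLOCK-LOCAL DENSITY `≲ |cQ|·n⁻⁸` AND THE PACKED `Q′*Q′` TABLE FACTORISES INTO TWO OF THEM (`≲ |x₀||cQ|·n⁻¹²`)**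

HONEST DEPENDENCY (cell records, verbatim): «continuum YM on T⁴ ⇐ BetaPertH ∧ nine spine estimates (0/9 proved); BetaPertH ⇐ (D1) ∧ (D4) ∧
CAP+tail; G-an2-4 gates asym, D1 and NE2/3/4.»  HONEST FRAMING (cell contract, verbatim): «discharging `BetaPertH` makes Bałaban's UV stability
UNCONDITIONAL — a real constructive-QFT result; it is NOT the continuum limit and NOT the Clay problem.»  THIS MODULE DISCHARGES NOTHING of the
wall: [folklore] `tsum`∕block-sum bookkeeping over OUR packed objects (leaf-01's `GhostStencilRooted.qAntiAt ∕ SghAt`, leaf-03's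
`GhostAveragingSquare.qSqAt ∕ WghAt`, the typer's `ReducedKernelF.vertexRedF` ∕ `ReducedTableF.tableRedF`) composed BY NAME with gan24-leaf-05's bond
marginal `NeedleBondMarginal.sum_bond_abs_qAntiAt_le_of_root` and this lineage's F4 weight density `GhostVertexDensities.abs_ghostWeight_le`.
No definition, no `def … : Prop`, nothing cited, 0 sorry.  0 root-level binders of row D1 discharged (hW ∕ hR-sockets ∕ hSX-socket ∕ D1Tel ∕ D1Rep = 0);
(K) NOT closed; NOT D1, NOT `BetaPertH`, NOT continuum, NOT Clay.

ABSOLUTE RULE (cell charter, verbatim): «No internally-minted statement may enter as a cited fact. Every hypothesis is either kernel-proved in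
this package or a verbatim quotation of a PUBLISHED theorem with page reference. The manuscript(s) under audit are NOT citable for their own
disputed steps — they are the thing under adjudication; programme-internal (2001/route/tribunal) claims are never citable.»

WHY (GHOST-N8-SPEC v0.3 §3 (d3-Δ) ∕ L-Q′; journal ONLINE [D1LEAF04-G27-ONLINE]).  The `cQ`-defect `ΔGH` of the completed ghost kernel is four words
(`GhostDeltaWords.deltaGH_eq_words`) whose jets are the packed `Q′`-vertex `V_Q μ y := vertexRedF n (SghAt ρ n 0 cQ) μ y` and the packed `Q′*Q′` table
`W_Q := tableRedF n (WghAt ρ n x₀ 0 cQ)`.  `RestKernelGhostDelta` priced them by their MASSES (`V_Q = O(|cQ|)·n⁰`, `W_Q = O(n⁻¹)`) and got the row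
`KΔ(a)·n⁻¹`.  The sharp rows (this lineage's F5, `n⁻⁸` at the tower weight) need the ENTRYWISE letter instead: at a fixed fine pair `(x, z)` the
packed vertex is `cQ·Σ_κ Σ_u wH κ μ (u − n•y)·qAntiAt ρ n κ u x z`, and for a FIXED pair the bond sum `Σ_u |qAntiAt ρ n κ u x z|` is gan24-leaf-05's
BOND MARGINAL `≤ 2(n−1)·n⁻⁴` (the averaging contour through `z` meets `≤ n − 1` bonds per axis) — against the weight's sup `≲ n⁻⁵` on the block this is
`n⁻⁸`, with the column's centre damping carried to `z` inside the block.  The table needs no second count: leaf-03's `qSqAt κ u λ u′ = qAntiAt κ u · qAntiAt λ u′`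
POINTWISE, so the doubly packed table is the PRODUCT of two packed bond sums.

CONTENT ([folklore]; `n = m + 1`; `κ₄ := kappa163 4`, `M₅ := MG163 4·periodConst (kappa163 4) 3`; in-block root `0 ≤ ρ_i < n` where marked).
* §1 `vertexRedF_SghAt_Q_apply` (the packed `Q′`-vertex entrywise is `cQ ×` the packed bond sum `Σ_κ Σ'_u wH·qAntiAt`), `bondSum_tsum_eq_sum` (the `u`-sum is
  the finite sum over the block of `z`), `bondSum_eq_zero_of_blk_ne` (support `blk x = blk z`), `exp_centre_blockmate` (centre transfer inside a block costs `e^{κ₄∕4}`).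
* §2 **`abs_bondSum_le`**: `|Σ_κ Σ'_u wH κ μ (u − n•y)·qAntiAt ρ n κ u x z| ≤ 8·((n⁸)⁻¹·M₅·e^{κ₄∕4})·e^{κ₄∕4}·e^{−((κ₄∕16)∕n)‖z − n•y‖∞}`.
* §3 **`abs_vertexRedF_SghAt_Q_le`** (the same times `|cQ|`), `vertexRedF_SghAt_Q_eq_zero_of_blk_ne`.
* §4 **`tableRedF_qSqAt_apply_eq_mul`** (factorisation), **`abs_tableRedF_WghAt_Q_le`**
  (`≤ |x₀|·|cQ|·n⁴·(8·((n⁸)⁻¹M₅e^{κ₄∕4})·e^{κ₄∕4})²·e^{−((κ₄∕16)∕n)‖z − n•y‖∞}·e^{−((κ₄∕16)∕n)‖z − n•y′‖∞}`), `tableRedF_WghAt_Q_eq_zero_of_blk_ne`.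
NOT HERE (honest): the words and the rows (`RestKernelGhostDeltaSharp`); anything of the END.
Unit `b2b-balaban-beta-d1-formalise-leaf-04` (gen 27), D1 formalisation swarm, road «BF-x»; INTENT-1 [D1LEAF04-G27-INTENT-1]. Not in print; no existing file touched.
-/

noncomputable section

namespace Summit.QuantumFields.BalabanUV.Beta.D1BFx.GhostQVertexDensity

open scoped BigOperators
open Finset
open Literature.MathematicalPhysics.QuantumFieldTheory.Balaban1983to89
open Literature.MathematicalPhysics.QuantumFieldTheory.Balaban1983to89.Beta
open B12Sec2to5 (l1 l1_nonneg)
open B5Hk163Strip (kappa163 kappa163_pos)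
open B5Hk163Decay (MG163)
open B4TorusKernel (periodConst)
open B6QGQLower276 (blk B mem_B)
open ExpKernelCalculus (Site MKer)
open KernelSpecInstance (wH)
open OneStepResolventKernel (wsum)
open PoissonInterior (supNorm supNorm_add_le supNorm_neg)
open Summit.QuantumFields.BalabanUV.Beta.D1BFx.GhostStencil (l1_sub_le_of_blk_eq)
open Summit.QuantumFields.BalabanUV.Beta.D1BFx.GhostStencilRooted (qAntiAt SghAt SghAt_apply)
open Summit.QuantumFields.BalabanUV.Beta.D1BFx.GhostAveragingSquare (qSqAt qSqAt_apply WghAt qAntiAt_eq_zero_of_blk_ne)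
open Summit.QuantumFields.BalabanUV.Beta.D1BFx.ReducedKernelF (vertexRedF vertexRedF_apply)
open Summit.QuantumFields.BalabanUV.Beta.D1BFx.ReducedTableF (tableRedF tableRedF_apply)
open Summit.QuantumFields.BalabanUV.Beta.D1BFx.GhostDeltaJetLetters (qAntiAt_eq_zero_of_not_blk)
open Summit.QuantumFields.BalabanUV.Beta.D1BFx.GhostDeltaJetMasses (tableRedF_WghAt_Q)
open Summit.QuantumFields.BalabanUV.Beta.D1BFx.GhostVertexDensities (abs_ghostWeight_le cast_supNorm_le_l1)
open Summit.QuantumFields.BalabanUV.Beta.D1BFx.NeedleBondMarginal (sum_bond_abs_qAntiAt_le_of_root)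

variable (m : ℕ) (ρ : Site 4)

/-! ## §1 The packed `Q′`-vertex entrywise: `cQ ×` a finite bond sum over one block -/

/-- [our object] **THE PACKED `Q′`-VERTEX ENTRYWISE**: `vertexRedF n (SghAt ρ n 0 cQ) μ y x z = cQ · Σ_κ Σ'_u wH κ μ (u − n•y) · qAntiAt ρ n κ u x z`. -/
theorem vertexRedF_SghAt_Q_apply (cQ : ℝ) (μ : Fin 4) (y x z : Site 4) (g f : Unit) :
    vertexRedF (m + 1) (SghAt ρ (m + 1) 0 cQ) μ y x z g f
      = cQ * ∑ κ : Fin 4, ∑' u : Site 4, wH (N := m + 1) (d := 3) κ μ (u - ((m + 1 : ℕ) : ℤ) • y) * qAntiAt ρ (m + 1) κ u x z () () := by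
  obtain rfl : g = () := Subsingleton.elim _ _
  obtain rfl : f = () := Subsingleton.elim _ _
  rw [vertexRedF_apply, Finset.mul_sum]
  refine Finset.sum_congr rfl fun κ _ => ?_
  unfold OneStepResolventKernel.wsum
  rw [← tsum_mul_left]
  refine tsum_congr fun u => ?_
  rw [SghAt_apply]
  ring

/-- [folklore] **THE BOND SUM IS A FINITE SUM OVER THE BLOCK OF `z`**: the stripped jet `qAntiAt ρ n κ u x z` vanishes unless `blk u = blk z`
(`GhostDeltaJetLetters.qAntiAt_eq_zero_of_not_blk`), so `Σ'_u wH·qAntiAt = Σ_{u ∈ B (blk z)} wH·qAntiAt`. -/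
theorem bondSum_tsum_eq_sum (μ : Fin 4) (y x z : Site 4) (κ : Fin 4) :
    ∑' u : Site 4, wH (N := m + 1) (d := 3) κ μ (u - ((m + 1 : ℕ) : ℤ) • y) * qAntiAt ρ (m + 1) κ u x z () ()
      = ∑ u ∈ B (m + 1 - 1) (blk (m + 1 - 1) z), wH (N := m + 1) (d := 3) κ μ (u - ((m + 1 : ℕ) : ℤ) • y) * qAntiAt ρ (m + 1) κ u x z () () :=
  tsum_eq_sum fun u hu => by
    rw [qAntiAt_eq_zero_of_not_blk ρ (m + 1) κ u (fun h => hu (mem_B.2 h.2.symm)), mul_zero]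

/-- [folklore] **SUPPORT**: off the common block of `x` and `z` the bond sum vanishes (`GhostAveragingSquare.qAntiAt_eq_zero_of_blk_ne`). -/
theorem bondSum_eq_zero_of_blk_ne (μ : Fin 4) (y : Site 4) {x z : Site 4} (h : blk (m + 1 - 1) x ≠ blk (m + 1 - 1) z) :
    ∑ κ : Fin 4, ∑' u : Site 4, wH (N := m + 1) (d := 3) κ μ (u - ((m + 1 : ℕ) : ℤ) • y) * qAntiAt ρ (m + 1) κ u x z () () = 0 := by
  refine Finset.sum_eq_zero fun κ _ => ?_
  have h0 : ∀ u : Site 4, wH (N := m + 1) (d := 3) κ μ (u - ((m + 1 : ℕ) : ℤ) • y) * qAntiAt ρ (m + 1) κ u x z () () = 0 := fun u => by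
    rw [qAntiAt_eq_zero_of_blk_ne ρ (m + 1) κ u h () (), mul_zero]
  simp only [h0, tsum_zero]

/-- [folklore] **CENTRE TRANSFER INSIDE A BLOCK** costs `e^{κ₄∕4}` at the road's rate `(κ₄∕16)∕n`: for block-mates `u`, `z`
(`‖z − u‖∞ ≤ |z − u|₁ ≤ 4n`), `e^{−((κ₄∕16)∕n)‖u − C‖∞} ≤ e^{κ₄∕4}·e^{−((κ₄∕16)∕n)‖z − C‖∞}`. -/
theorem exp_centre_blockmate {u z : Site 4} (h : blk (m + 1 - 1) z = blk (m + 1 - 1) u) (C : Site 4) :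
    Real.exp (-(kappa163 4 / 16 / ((m + 1 : ℕ) : ℝ)) * supNorm (u - C))
      ≤ Real.exp (kappa163 4 / 4) * Real.exp (-(kappa163 4 / 16 / ((m + 1 : ℕ) : ℝ)) * supNorm (z - C)) := by
  have hn : (0 : ℝ) < ((m + 1 : ℕ) : ℝ) := by exact_mod_cast Nat.succ_pos m
  have hκ : 0 ≤ kappa163 4 := (kappa163_pos 4).le
  have h1 : l1 (z - u) ≤ 4 * (((m + 1 : ℕ) : ℝ)) := l1_sub_le_of_blk_eq (m + 1) h
  have h2 : (supNorm (z - u) : ℝ) ≤ l1 (z - u) := cast_supNorm_le_l1 _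
  have h3 : supNorm (z - C) ≤ supNorm (z - u) + supNorm (u - C) := by
    have := supNorm_add_le (z - u) (u - C); rwa [show z - u + (u - C) = z - C by abel] at this
  have h3' : (supNorm (z - C) : ℝ) ≤ supNorm (z - u) + supNorm (u - C) := by exact_mod_cast h3
  rw [← Real.exp_add]
  apply Real.exp_le_exp.mpr
  have hc : 0 ≤ kappa163 4 / 16 / ((m + 1 : ℕ) : ℝ) := by positivity
  have e4 : kappa163 4 / 16 / ((m + 1 : ℕ) : ℝ) * (4 * ((m + 1 : ℕ) : ℝ)) = kappa163 4 / 4 := by field_simp; ring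
  nlinarith [mul_le_mul_of_nonneg_left (h2.trans h1) hc, mul_le_mul_of_nonneg_left h3' hc]

/-! ## §2 The packed bond sum is `≲ n⁻⁸`, damped at the column's centre -/

section Root

variable {ρ} (hρ : ∀ i : Fin 4, 0 ≤ ρ i ∧ ρ i < (m + 1 : ℕ))
include hρ

/-- [folklore] **THE PACKED BOND SUM IS A BLOCK-LOCAL DENSITY OF SIZE `n⁻⁸`** (in-block root): for every `μ y x z`,
`|Σ_κ Σ'_u wH κ μ (u − n•y)·qAntiAt ρ n κ u x z| ≤ 8·((n⁸)⁻¹·M₅·e^{κ₄∕4})·e^{κ₄∕4}·e^{−((κ₄∕16)∕n)‖z − n•y‖∞}` — the weight's sup on the block of `z`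
(F4 `abs_ghostWeight_le`, `(n⁵)⁻¹M₅e^{κ₄∕4}`, centre moved to `z`) times gan24-leaf-05's bond marginal `Σ_{u} |qAntiAt ρ n κ u x z| ≤ 2(n−1)n⁻⁴` per axis. -/
theorem abs_bondSum_le (μ : Fin 4) (y x z : Site 4) :
    |∑ κ : Fin 4, ∑' u : Site 4, wH (N := m + 1) (d := 3) κ μ (u - ((m + 1 : ℕ) : ℤ) • y) * qAntiAt ρ (m + 1) κ u x z () ()|
      ≤ 8 * ((((m + 1 : ℕ) : ℝ) ^ 8)⁻¹ * (MG163 4 * periodConst (kappa163 4) 3) * Real.exp (kappa163 4 / 4)) * Real.exp (kappa163 4 / 4)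
        * Real.exp (-(kappa163 4 / 16 / ((m + 1 : ℕ) : ℝ)) * supNorm (z - ((m + 1 : ℕ) : ℤ) • y)) := by
  have hn : (0 : ℝ) < ((m + 1 : ℕ) : ℝ) := by exact_mod_cast Nat.succ_pos m
  have hn1 : (1 : ℝ) ≤ ((m + 1 : ℕ) : ℝ) := by exact_mod_cast Nat.le_add_left 1 m
  set N : ℝ := ((m + 1 : ℕ) : ℝ) with hN
  set K₅ : ℝ := (N ^ 5)⁻¹ * (MG163 4 * periodConst (kappa163 4) 3) * Real.exp (kappa163 4 / 4) with hK₅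
  set E : ℝ := Real.exp (-(kappa163 4 / 16 / N) * supNorm (z - ((m + 1 : ℕ) : ℤ) • y)) with hE
  -- the weight letter (F4 at `c = 1`) and its nonnegativity
  have hw : ∀ (κ : Fin 4) (u : Site 4), |wH (N := m + 1) (d := 3) κ μ (u - ((m + 1 : ℕ) : ℤ) • y)|
      ≤ K₅ * Real.exp (-(kappa163 4 / 16 / N) * supNorm (u - ((m + 1 : ℕ) : ℤ) • y)) := by
    intro κ u
    have h := abs_ghostWeight_le m 1 μ y κ u
    rw [one_mul, abs_one, one_mul] at h
    simpa only [hK₅, hN] using h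
  have hK₅0 : 0 ≤ K₅ := by
    have h := hw 0 (((m + 1 : ℕ) : ℤ) • y)
    rw [sub_self, show supNorm (0 : Site 4) = 0 from by simp [PoissonInterior.supNorm], Nat.cast_zero, mul_zero, Real.exp_zero, mul_one] at h
    exact (abs_nonneg _).trans h
  -- on the block of `z` the weight is at most `K₅·e^{κ₄∕4}·E`
  have hwB : ∀ (κ : Fin 4), ∀ u ∈ B (m + 1 - 1) (blk (m + 1 - 1) z), |wH (N := m + 1) (d := 3) κ μ (u - ((m + 1 : ℕ) : ℤ) • y)|
      ≤ K₅ * (Real.exp (kappa163 4 / 4) * E) := by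
    intro κ u hu
    have hb : blk (m + 1 - 1) z = blk (m + 1 - 1) u := (mem_B.1 hu).symm
    have hc := exp_centre_blockmate m hb (((m + 1 : ℕ) : ℤ) • y)
    rw [← hN] at hc
    exact (hw κ u).trans (mul_le_mul_of_nonneg_left hc hK₅0)
  -- per axis: the block sum of |weight|·|jet| against the bond marginal
  have haxis : ∀ κ : Fin 4, |∑' u : Site 4, wH (N := m + 1) (d := 3) κ μ (u - ((m + 1 : ℕ) : ℤ) • y) * qAntiAt ρ (m + 1) κ u x z () ()|
      ≤ K₅ * (Real.exp (kappa163 4 / 4) * E) * (2 * ((N - 1) * (N ^ 4)⁻¹)) := by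
    intro κ
    rw [bondSum_tsum_eq_sum m ρ μ y x z κ]
    refine (Finset.abs_sum_le_sum_abs _ _).trans ?_
    calc ∑ u ∈ B (m + 1 - 1) (blk (m + 1 - 1) z), |wH (N := m + 1) (d := 3) κ μ (u - ((m + 1 : ℕ) : ℤ) • y) * qAntiAt ρ (m + 1) κ u x z () ()|
        ≤ ∑ u ∈ B (m + 1 - 1) (blk (m + 1 - 1) z), K₅ * (Real.exp (kappa163 4 / 4) * E) * |qAntiAt ρ (m + 1) κ u x z () ()| :=
          Finset.sum_le_sum fun u hu => by
            rw [abs_mul]; exact mul_le_mul_of_nonneg_right (hwB κ u hu) (abs_nonneg _)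
      _ = K₅ * (Real.exp (kappa163 4 / 4) * E) * ∑ u ∈ B (m + 1 - 1) (blk (m + 1 - 1) z), |qAntiAt ρ (m + 1) κ u x z () ()| := by
          rw [Finset.mul_sum]
      _ ≤ K₅ * (Real.exp (kappa163 4 / 4) * E) * (2 * ((N - 1) * (N ^ 4)⁻¹)) :=
          mul_le_mul_of_nonneg_left (by simpa only [hN] using sum_bond_abs_qAntiAt_le_of_root (m + 1) κ hρ _ x z () ()) (by positivity)
  -- four axes, then `(n − 1)·n⁻⁴·n⁻⁵ ≤ n⁻⁸`
  calc |∑ κ : Fin 4, ∑' u : Site 4, wH (N := m + 1) (d := 3) κ μ (u - ((m + 1 : ℕ) : ℤ) • y) * qAntiAt ρ (m + 1) κ u x z () ()|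
      ≤ ∑ κ : Fin 4, |∑' u : Site 4, wH (N := m + 1) (d := 3) κ μ (u - ((m + 1 : ℕ) : ℤ) • y) * qAntiAt ρ (m + 1) κ u x z () ()| :=
        Finset.abs_sum_le_sum_abs _ _
    _ ≤ ∑ _κ : Fin 4, K₅ * (Real.exp (kappa163 4 / 4) * E) * (2 * ((N - 1) * (N ^ 4)⁻¹)) := Finset.sum_le_sum fun κ _ => haxis κ
    _ = 8 * ((N - 1) * (N ^ 4)⁻¹ * (N ^ 5)⁻¹) * (MG163 4 * periodConst (kappa163 4) 3) * Real.exp (kappa163 4 / 4) * Real.exp (kappa163 4 / 4) * E := by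
        rw [Finset.sum_const, Finset.card_univ, Fintype.card_fin, nsmul_eq_mul, hK₅]
        push_cast
        ring
    _ ≤ 8 * (N ^ 8)⁻¹ * (MG163 4 * periodConst (kappa163 4) 3) * Real.exp (kappa163 4 / 4) * Real.exp (kappa163 4 / 4) * E := by
        have hM : 0 ≤ MG163 4 * periodConst (kappa163 4) 3 := by
          have h1 : 0 < (N ^ 5)⁻¹ := by positivity
          have h2 := (mul_nonneg_iff_of_pos_right (Real.exp_pos (kappa163 4 / 4))).1 hK₅0
          exact (mul_nonneg_iff_of_pos_left h1).1 h2
        have hpow : (N - 1) * (N ^ 4)⁻¹ * (N ^ 5)⁻¹ ≤ (N ^ 8)⁻¹ := by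
          rw [show (N - 1) * (N ^ 4)⁻¹ * (N ^ 5)⁻¹ = (N - 1) / N ^ 9 by field_simp, inv_eq_one_div,
            div_le_div_iff₀ (by positivity) (by positivity)]
          nlinarith [pow_pos hn 8]
        have hE0 : 0 ≤ E := (Real.exp_pos _).le
        have := mul_le_mul_of_nonneg_left hpow (by positivity : (0:ℝ) ≤ 8 * (MG163 4 * periodConst (kappa163 4) 3) * Real.exp (kappa163 4 / 4) * Real.exp (kappa163 4 / 4) * E)
        nlinarith [this]
    _ = _ := by rw [hE]; ring

/-! ## §3 The packed `Q′`-vertex: the same letter times `|cQ|`, support `blk x = blk z` -/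

/-- [folklore] **L-Q′ — THE PACKED `Q′`-VERTEX IS A BLOCK-LOCAL DENSITY**: for every `cQ μ y x z`,
`|vertexRedF n (SghAt ρ n 0 cQ) μ y x z| ≤ |cQ|·(8·((n⁸)⁻¹·M₅·e^{κ₄∕4})·e^{κ₄∕4})·e^{−((κ₄∕16)∕n)‖z − n•y‖∞}`. -/
theorem abs_vertexRedF_SghAt_Q_le (cQ : ℝ) (μ : Fin 4) (y x z : Site 4) (g f : Unit) :
    |vertexRedF (m + 1) (SghAt ρ (m + 1) 0 cQ) μ y x z g f|
      ≤ |cQ| * (8 * ((((m + 1 : ℕ) : ℝ) ^ 8)⁻¹ * (MG163 4 * periodConst (kappa163 4) 3) * Real.exp (kappa163 4 / 4)) * Real.exp (kappa163 4 / 4))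
        * Real.exp (-(kappa163 4 / 16 / ((m + 1 : ℕ) : ℝ)) * supNorm (z - ((m + 1 : ℕ) : ℤ) • y)) := by
  rw [vertexRedF_SghAt_Q_apply, abs_mul, mul_assoc]
  exact mul_le_mul_of_nonneg_left (abs_bondSum_le m hρ μ y x z) (abs_nonneg _)

end Root

/-- [folklore] **SUPPORT OF THE PACKED `Q′`-VERTEX**: `blk x ≠ blk z → vertexRedF n (SghAt ρ n 0 cQ) μ y x z = 0`. -/
theorem vertexRedF_SghAt_Q_eq_zero_of_blk_ne (cQ : ℝ) (μ : Fin 4) (y : Site 4) {x z : Site 4} (h : blk (m + 1 - 1) x ≠ blk (m + 1 - 1) z)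
    (g f : Unit) : vertexRedF (m + 1) (SghAt ρ (m + 1) 0 cQ) μ y x z g f = 0 := by
  rw [vertexRedF_SghAt_Q_apply, bondSum_eq_zero_of_blk_ne m ρ μ y h, mul_zero]

/-! ## §4 The packed `Q′*Q′` table factorises into two packed bond sums -/

/-- [folklore] **FACTORISATION OF THE PACKED STRIPPED SQUARE TABLE**: since `qSqAt ρ n κ u λ u′ x z = qAntiAt ρ n κ u x z · qAntiAt ρ n λ u′ x z` pointwise
(leaf-03's `GhostAveragingSquare.qSqAt`), the doubly packed table is the product of the two packed bond sums:
`tableRedF n (qSqAt ρ n) μ y ν y′ x z = (Σ_κ Σ'_u wH κ μ (u − n•y)·qAntiAt κ u x z)·(Σ_λ Σ'_{u′} wH λ ν (u′ − n•y′)·qAntiAt λ u′ x z)`. -/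
theorem tableRedF_qSqAt_apply_eq_mul (μ : Fin 4) (y : Site 4) (ν : Fin 4) (y' x z : Site 4) (g f : Unit) :
    tableRedF (m + 1) (qSqAt ρ (m + 1)) μ y ν y' x z g f
      = (∑ κ : Fin 4, ∑' u : Site 4, wH (N := m + 1) (d := 3) κ μ (u - ((m + 1 : ℕ) : ℤ) • y) * qAntiAt ρ (m + 1) κ u x z () ())
        * (∑ l : Fin 4, ∑' u' : Site 4, wH (N := m + 1) (d := 3) l ν (u' - ((m + 1 : ℕ) : ℤ) • y') * qAntiAt ρ (m + 1) l u' x z () ()) := by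
  obtain rfl : g = () := Subsingleton.elim _ _
  obtain rfl : f = () := Subsingleton.elim _ _
  rw [tableRedF_apply, Finset.sum_mul_sum]
  refine Finset.sum_congr rfl fun κ _ => Finset.sum_congr rfl fun l _ => ?_
  unfold OneStepResolventKernel.wsum
  -- inner sum: pull the first jet out
  have hinner : ∀ u : Site 4, ∑' u' : Site 4, wH (N := m + 1) (d := 3) l ν (u' - ((m + 1 : ℕ) : ℤ) • y') * qSqAt ρ (m + 1) κ u l u' x z () ()
      = qAntiAt ρ (m + 1) κ u x z () () *
          ∑' u' : Site 4, wH (N := m + 1) (d := 3) l ν (u' - ((m + 1 : ℕ) : ℤ) • y') * qAntiAt ρ (m + 1) l u' x z () () := by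
    intro u
    rw [← tsum_mul_left]
    refine tsum_congr fun u' => ?_
    rw [qSqAt_apply]
    ring
  simp only [hinner]
  rw [← tsum_mul_right]
  refine tsum_congr fun u => ?_
  ring

/-- [folklore] **SUPPORT OF THE PACKED TABLE**: `blk x ≠ blk z → tableRedF n (WghAt ρ n x₀ 0 cQ) μ y ν y′ x z = 0`. -/
theorem tableRedF_WghAt_Q_eq_zero_of_blk_ne (x₀ cQ : ℝ) (μ : Fin 4) (y : Site 4) (ν : Fin 4) (y' : Site 4) {x z : Site 4}
    (h : blk (m + 1 - 1) x ≠ blk (m + 1 - 1) z) (g f : Unit) : tableRedF (m + 1) (WghAt ρ (m + 1) x₀ 0 cQ) μ y ν y' x z g f = 0 := by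
  rw [tableRedF_WghAt_Q]
  show (-(x₀ * cQ * (((m + 1 : ℕ) : ℝ)) ^ 4)) * tableRedF (m + 1) (qSqAt ρ (m + 1)) μ y ν y' x z g f = 0
  rw [tableRedF_qSqAt_apply_eq_mul, bondSum_eq_zero_of_blk_ne m ρ μ y h, zero_mul, mul_zero]

section RootTable

variable {ρ} (hρ : ∀ i : Fin 4, 0 ≤ ρ i ∧ ρ i < (m + 1 : ℕ))
include hρ

/-- [folklore] **L-Q′ (TABLE) — THE PACKED `Q′*Q′` TABLE IS A BLOCK-LOCAL TWO-CENTRE DENSITY OF SIZE `n⁴·(n⁻⁸)² = n⁻¹²`**: for every `x₀ cQ μ y ν y′ x z`,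
`|tableRedF n (WghAt ρ n x₀ 0 cQ) μ y ν y′ x z| ≤ |x₀|·|cQ|·n⁴·(8·((n⁸)⁻¹M₅e^{κ₄∕4})·e^{κ₄∕4})²·e^{−((κ₄∕16)∕n)‖z − n•y‖∞}·e^{−((κ₄∕16)∕n)‖z − n•y′‖∞}`. -/
theorem abs_tableRedF_WghAt_Q_le (x₀ cQ : ℝ) (μ : Fin 4) (y : Site 4) (ν : Fin 4) (y' x z : Site 4) (g f : Unit) :
    |tableRedF (m + 1) (WghAt ρ (m + 1) x₀ 0 cQ) μ y ν y' x z g f|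
      ≤ |x₀| * |cQ| * (((m + 1 : ℕ) : ℝ)) ^ 4
          * (8 * ((((m + 1 : ℕ) : ℝ) ^ 8)⁻¹ * (MG163 4 * periodConst (kappa163 4) 3) * Real.exp (kappa163 4 / 4)) * Real.exp (kappa163 4 / 4)) ^ 2
        * Real.exp (-(kappa163 4 / 16 / ((m + 1 : ℕ) : ℝ)) * supNorm (z - ((m + 1 : ℕ) : ℤ) • y))
        * Real.exp (-(kappa163 4 / 16 / ((m + 1 : ℕ) : ℝ)) * supNorm (z - ((m + 1 : ℕ) : ℤ) • y')) := by
  have hn : (0 : ℝ) ≤ ((m + 1 : ℕ) : ℝ) := Nat.cast_nonneg _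
  rw [tableRedF_WghAt_Q]
  show |(-(x₀ * cQ * (((m + 1 : ℕ) : ℝ)) ^ 4)) * tableRedF (m + 1) (qSqAt ρ (m + 1)) μ y ν y' x z g f| ≤ _
  rw [tableRedF_qSqAt_apply_eq_mul, abs_mul, abs_neg, abs_mul, abs_mul, abs_of_nonneg (pow_nonneg hn 4), abs_mul]
  have h1 := abs_bondSum_le m hρ μ y x z
  have h2 := abs_bondSum_le m hρ ν y' x z
  set A : ℝ := 8 * ((((m + 1 : ℕ) : ℝ) ^ 8)⁻¹ * (MG163 4 * periodConst (kappa163 4) 3) * Real.exp (kappa163 4 / 4)) * Real.exp (kappa163 4 / 4) with hA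
  have h12 := mul_le_mul h1 h2 (abs_nonneg _) ((abs_nonneg _).trans h1)
  calc |x₀| * |cQ| * (((m + 1 : ℕ) : ℝ)) ^ 4 *
        (|∑ κ : Fin 4, ∑' u : Site 4, wH (N := m + 1) (d := 3) κ μ (u - ((m + 1 : ℕ) : ℤ) • y) * qAntiAt ρ (m + 1) κ u x z () ()| *
          |∑ l : Fin 4, ∑' u' : Site 4, wH (N := m + 1) (d := 3) l ν (u' - ((m + 1 : ℕ) : ℤ) • y') * qAntiAt ρ (m + 1) l u' x z () ()|)
      ≤ |x₀| * |cQ| * (((m + 1 : ℕ) : ℝ)) ^ 4 *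
        (A * Real.exp (-(kappa163 4 / 16 / ((m + 1 : ℕ) : ℝ)) * supNorm (z - ((m + 1 : ℕ) : ℤ) • y)) *
          (A * Real.exp (-(kappa163 4 / 16 / ((m + 1 : ℕ) : ℝ)) * supNorm (z - ((m + 1 : ℕ) : ℤ) • y')))) :=
        mul_le_mul_of_nonneg_left h12 (by positivity)
    _ = _ := by ring

end RootTable

end Summit.QuantumFields.BalabanUV.Beta.D1BFx.GhostQVertexDensity

end
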